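import Summits.BirchSwinnertonDyer.BirchSwinnertonDyer.Theorems.UniversalToricDescentTwinTowerResidualCount
import Summits.BirchSwinnertonDyer.BirchSwinnertonDyer.Theorems.UniversalToricDescentTwinTowerSigmaProduct
import Summits.BirchSwinnertonDyer.BirchSwinnertonDyer.Theorems.UniversalToricDescentDefectTransportTwinBaseFiniteOnly
import HarnessLib

/-!
# Route UniversalToricDescent — stub B′ `stub_lambdaTransportPT` of ♭T′ RANK-FREE MODULO THREE TOWER-LEVEL STATEMENTS
# ABOUT THE TWIN: the algebraic half of the defect transport from the wall + (S′) strict-place surjectivity for `E′`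
# + (Σ′) `Σ`-local surjectivity for `E′` + (N′) no non-zero finite `Λ`-submodule of `X_{𝔭′}^S(E′/K_∞)`

Lead prover bsd-wall-utd-p1 g14 (`--supports` ♭T′ stmt-BirchSwinnertonDyer-26975 `DefectTransportModThreePT`; line `sigmacongruence`,
stub B′, RANK-FREE road; memo RESIDUE-B-PRIME-utdp1g13 §10). g13 closed B′ modulo (R1) the twin's base finiteness
`Sel_v(K, E′[3^∞]) < ∞` (`…_of_twinBaseFinite_of_not_addv`, p628702), FALSE for congruent twins of `K`-rank `≥ 2`. (R1) enters
only through three TOWER-level consequences for `E′` over `K_∞` — Greenberg–Vatsal Prop. 2.1 at the strict place (S′),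
Cor. 2.3 at the places of `Σ` (Σ′), and Prop. 2.5 / (N1) for `X^S` (N′) — each expected from the `Λ`-torsion of
`X_{∅,0}(E′/K_∞)` by Greenberg's twisted descent (LNM 1716 Prop. 4.13–4.15). This file makes them the ONLY residue:

* §1 `natCard_selmerAc_pTorsion_baseChange_eq_of_modPCongruent_of_twinTower` — (M1) on the route with the twin's base
  finiteness replaced by (S′) (via `…TwinTowerResidualCount` + the tuple adapter of `…TwinTowerSigmaProduct`) and (N′)^S;
* §2 **`defectTransport_algebraicHalf_lambda_of_wall_of_twinTower`** — stub B′'s conclusion VERBATIM ⟸ B′'s binders +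
  (S′) + (Σ′) + (N′) (hypotheses `hsig'`, `hsigS'`, `hnf'`), through the FRAME `…_of_wall_of_residual` (p622704): `hcmp` = §1,
  `hnf'` at `S = ∅`, `hprodTwin` = `natCard_quotient_pTorsion_eq_prod_of_surj` fed by (Σ′) and the divisibility from (N′)^S.

HONEST STATUS: helper theorems, CONDITIONAL on the cited Poitou–Tate facts (wild side) and on the three twin tower statements
(hypotheses; the residue of stub B′ — to be supplied by the twisted descent). Stub B′, B″ 27121 and ♭T′ remain OPEN. THEOREMS
ONLY; no definition, no named fact, no `sorry`. BSD is not advanced by this file.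
References: [GreenbergVatsal2000] Thm. (1.4), §2 Prop. (2.1), Cor. (2.3), (2.4), (2.5), (2.8), (2.10) (pp. 23–28);
[GreenbergLNM1716] §4 pp. 122–126; [Brink2007] Cor. 1; [Serre1967GroupesPDivisibles] §5 Prop. 8.
-/

set_option autoImplicit false
-- `…BirchSwinnertonDyer.BirchSwinnertonDyer.Theorems…` is the problem's mandated namespace (D-0017).
set_option linter.dupNamespace false

noncomputable section
open scoped Classical

namespace Summit.BirchSwinnertonDyer.BirchSwinnertonDyer.Theorems.UniversalToricDescentDefectTransport

open Function Field NumberField IsDedekindDomain WeierstrassCurve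
open Literature.NumberTheory.GaloisRepresentations Literature.NumberTheory.EllipticCurves
  Literature.NumberTheory.EllipticCurves.GreenbergSelmer Literature.NumberTheory.GaloisCohomology
  Literature.NumberTheory.EllipticCurves.IwasawaAlgebra Literature.NumberTheory.EllipticCurves.Rank1Residual
  Summit.BirchSwinnertonDyer.Rank1Residual Summit.BirchSwinnertonDyer.Rank1Residual.X11b
  Summit.BirchSwinnertonDyer.Rank1Residual.X11b.Coinv Summit.BirchSwinnertonDyer.Rank1Residual.X11b.AcSelmer
  Summit.BirchSwinnertonDyer.Rank1Residual.X11b.LocBridge Summit.BirchSwinnertonDyer.Rank1Residual.Iwasawa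
  Summit.BirchSwinnertonDyer.BirchSwinnertonDyer.Theorems.UniversalToricDescentSigmaPassage
  Summit.BirchSwinnertonDyer.BirchSwinnertonDyer.Theorems.UniversalToricDescentSigmaLocalImage
  Summit.BirchSwinnertonDyer.BirchSwinnertonDyer.Theorems.UniversalToricDescentSigmaLocalStabilizer
  Summit.BirchSwinnertonDyer.BirchSwinnertonDyer.Theorems.UniversalToricDescentSigmaCoinvariants
  Summit.BirchSwinnertonDyer.BirchSwinnertonDyer.Theorems.UniversalToricDescentAcDualMuZero
  Summit.BirchSwinnertonDyer.BirchSwinnertonDyer.Theorems.UniversalToricDescentTorsionMuTransportHeegner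
  Summit.BirchSwinnertonDyer.BirchSwinnertonDyer.Theorems.UniversalToricDescentStrictPlaceTuple
  Summit.BirchSwinnertonDyer.BirchSwinnertonDyer.Theorems.UniversalToricDescentResidualSelmer
  Summit.BirchSwinnertonDyer.BirchSwinnertonDyer.Theorems.SchneiderFreeAdditiveX3
  Summit.BirchSwinnertonDyer.BirchSwinnertonDyer.Theorems.SchneiderFreeControlAtoms
  Summit.BirchSwinnertonDyer.BirchSwinnertonDyer.Theorems.PotentiallySupersingularLocalTorsion

/-! ### §1 (M1) on the route with the twin's base data replaced by (S′) and (N′)^S -/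

/-- **`#Sel_𝔭^Σ(K_∞, W_K[p^∞])[p] = #Sel_𝔭^Σ(K_∞, W′_K[p^∞])[p]`** for `W, W′/ℚ` with `W′[p] ≅ W[p]`, `ρ̄_{W,p}` onto, `p` odd, `K`
imaginary quadratic with `p` split, `κ` anticyclotomic with topological generator `γ`, `𝔭 ∋ p` the strict place, `Σ` finite prime
to `p` containing the bad places; GIVEN Poitou–Tate ×2 and base finiteness at both `v ∣ p` for the WILD curve `W` only,
`Sel_𝔭^Σ(K_∞, W_K[p^∞])[p]` finite, local tower torsion finiteness at `𝔭` for both, and for the TWIN the two tower statements: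
(S′) every tuple signature at `𝔭` is realised in `G_rel^Σ(K_∞, W′_K[p^∞])` (`hsurj'`, for the fake strict place / exact index
chosen inside — hence quantified), the `p`-divisibility of `Sel_𝔭^Σ(K_∞, W′_K[p^∞])` granted its finite `p`-torsion (`hdiv'`; from (N′)^Σ by
`selmerAc_divisible_of_finite_pTorsion_of_noFinite`). g13's
`natCard_selmerAc_pTorsion_baseChange_eq_of_modPCongruent_noL` with `hfin'` so replaced. [cite: GreenbergVatsal2000, §2 Prop. (2.1), (2.8)]
[cite: Brink2007, Cor. 1] [cite: MilneADT2006, Ch. I, Thm. 4.10] -/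
theorem natCard_selmerAc_pTorsion_baseChange_eq_of_modPCongruent_of_twinTower (W W' : WeierstrassCurve ℚ) [W.IsElliptic]
    [W.IsGloballyMinimal] [W'.IsElliptic] [W'.IsGloballyMinimal] (p : ℕ) [Fact p.Prime] (hp2 : p ≠ 2)
    {K : Type} [Field K] [NumberField K] (hK : IsImaginaryQuadratic K) (hsplit : SplitsIn K p)
    (hPT : poitouTate_selmerStructure_duality K) (hPT2 : poitouTate_sha_tateDual K)
    (κ : ZpExtension K p) (hκ : κ.IsAnticyclotomic) {γ : absoluteGaloisGroup K} (hγ : κ.IsTopGenerator γ)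
    {𝔭 : HeightOneSpectrum (𝓞 K)} (h𝔭 : ((p : ℕ) : 𝓞 K) ∈ 𝔭.asIdeal)
    (hsurj : W.HasSurjectiveModNGaloisRep (p : ℤ)) (hcong : O6.ModPCongruent W' W p)
    {S : Set (HeightOneSpectrum (𝓞 K))} (hS : S.Finite)
    (hSW : ∀ v : HeightOneSpectrum (𝓞 K), v ∉ S → ((p : ℕ) : 𝓞 K) ∉ v.asIdeal →
      (W.baseChange K).HasGoodReductionAt v)
    (hSW' : ∀ v : HeightOneSpectrum (𝓞 K), v ∉ S → ((p : ℕ) : 𝓞 K) ∉ v.asIdeal →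
      (W'.baseChange K).HasGoodReductionAt v)
    (hfin : ∀ v : HeightOneSpectrum (𝓞 K), ((p : ℕ) : 𝓞 K) ∈ v.asIdeal →
      Finite (selmerAcBase (W.baseChange K) p v ∅))
    (hsurj' : ∀ (v₀ : HeightOneSpectrum (𝓞 K)), ((p : ℕ) : 𝓞 K) ∉ v₀.asIdeal → v₀ ∉ S → ∀ (c : ℕ),
      (∀ z : ℤ_[p], ∃ d : decomp (K := K) 𝔭, (κ (d : absoluteGaloisGroup K)).toAdd = (p : ℤ_[p]) ^ c * z) →
      (∀ d : decomp (K := K) 𝔭, (p : ℤ_[p]) ^ c ∣ (κ (d : absoluteGaloisGroup K)).toAdd) →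
      ∀ g : Fin (p ^ c) → subgroupH1 (kerD κ 𝔭) ((W'.baseChange K).geomPrimaryTorsion p),
        ∃ s ∈ selmerAc (W'.baseChange K) p κ v₀ S, ∀ i : Fin (p ^ c),
          resKerD κ ((W'.baseChange K).geomPrimaryTorsion p) 𝔭
            ((W'.baseChange K).conjH1 p κ.kerSubgroup (γ ^ (i : ℕ)) s) = g i)
    (hdiv' : Set.Finite {s : selmerAc (W'.baseChange K) p κ 𝔭 S | p • s = 0} →
      ∀ s ∈ selmerAc (W'.baseChange K) p κ 𝔭 S, ∃ s' ∈ selmerAc (W'.baseChange K) p κ 𝔭 S, p • s' = s)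
    (hfinS : Set.Finite {s : selmerAc (W.baseChange K) p κ 𝔭 S | p • s = 0})
    (hδ : LocalTowerTorsionFiniteAt (W.baseChange K) p κ 𝔭)
    (hδ' : LocalTowerTorsionFiniteAt (W'.baseChange K) p κ 𝔭) :
    Nat.card {s : selmerAc (W.baseChange K) p κ 𝔭 S // p • s = 0} =
      Nat.card {s : selmerAc (W'.baseChange K) p κ 𝔭 S // p • s = 0} := by
  haveI : IsTotallyComplex K := hK.2
  haveI hEK : (W.baseChange K).IsElliptic := by rw [WeierstrassCurve.baseChange]; infer_instance
  haveI hEK' : (W'.baseChange K).IsElliptic := by rw [WeierstrassCurve.baseChange]; infer_instance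
  -- the conjugate prime `𝔮` (degree one) and the killing exponents there
  obtain ⟨σ, 𝔮, -, hne, h𝔮, -⟩ :=
    LocalIndexTransport.exists_conj_prime_of_splitsIn K p hK.1 hsplit h𝔭
  obtain ⟨he𝔮, hf𝔮⟩ := degreeOne_of_splitsIn hK.1 hsplit h𝔮
  obtain ⟨m₁, hm₁⟩ := exists_pow_nsmul_fixedPoints_decomp_eq_zero W p 𝔮 h𝔮 he𝔮 hf𝔮
  -- `H²(K, W_K[p^∞]) = 0` (wild curve)
  have htor := exists_pow_nsmul_local_eq_zero W p hK.1 hsplit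
  haveI := hfin 𝔭 h𝔭
  have h2 := subsingleton_galoisCohomology_two_primary_anyTorsion (W.baseChange K) p 𝔭 ∅ hPT2
    (fieldCdLE_two_of_isTotallyComplex fieldCdLE_two_of_numberField_holds K p) htor
  -- `𝔭` is finitely decomposed (Brink) with exact index `p^c`
  have hv : ¬ (decomp 𝔭 ≤ κ.kerSubgroup) :=
    ZpExtension.decomp_not_le_kerSubgroup_above_of_isAnticyclotomic_holds K p hK hp2 κ hκ 𝔭 h𝔭
  obtain ⟨c, -, hc, hle⟩ := exists_pow_and_forall_dvd_of_not_le κ 𝔭 hv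
  -- a fake strict place `v₀ ∤ p` outside `Σ`
  haveI : Infinite (HeightOneSpectrum (𝓞 K)) := Literature.NumberTheory.Automorphic.infinite_heightOneSpectrum K
  have hp0 : p ≠ 0 := (Fact.out : p.Prime).ne_zero
  obtain ⟨v₀, hv₀⟩ := ((hS.union (H2Support.finite_setOf_natCast_mem (K := K) p hp0)).infinite_compl).nonempty
  have hv₀S : v₀ ∉ S := fun h ↦ hv₀ (Or.inl h)
  have hv₀p : ((p : ℕ) : 𝓞 K) ∉ v₀.asIdeal := fun h ↦ hv₀ (Or.inr h)
  -- `W(K_∞)[p] = 0`, the torsion isomorphism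
  have hG : ∀ m : (W.baseChange K).geomPrimaryTorsion p, (∀ σ ∈ κ.kerSubgroup, σ • m = m) → p • m = 0 → m = 0 := by
    intro m hm _
    have hmem : m ∈ FixedPoints.addSubgroup κ.kerSubgroup (geomPrimaryTorsion (W.baseChange K) p) := fun g ↦ hm g g.2
    rw [UniversalToricDescentTowerTorsion.fixedPoints_kerSubgroup_geomPrimaryTorsion_baseChange_eq_bot_of_surjective W p
      hsurj K hK κ] at hmem
    exact (AddSubgroup.mem_bot).mp hmem
  obtain ⟨e, he⟩ := UniversalToricDescentResidualSelmerTransfer.exists_torsionIso_baseChange_of_modPCongruent (K := K) W W' hcong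
  have hes : ∀ (σ : absoluteGaloisGroup K) (P : (W.baseChange K).geomTorsion (p : ℤ)),
      e.symm (σ • P) = σ • e.symm P := fun σ P ↦ by
    apply e.injective; rw [e.apply_symm_apply, he, e.apply_symm_apply]
  -- divisibility: `Sel = p·Sel` for both (for the twin from the finiteness the count provides)
  have hEP : ∀ v : HeightOneSpectrum (𝓞 K), localEulerPoincareCharacteristic (v.adicCompletion K) :=
    fun v ↦ GaloisImage.EP.localEulerPoincareCharacteristic_adicCompletion K v
  have hdiv : ∀ s ∈ selmerAc (W.baseChange K) p κ 𝔭 S, ∃ s' ∈ selmerAc (W.baseChange K) p κ 𝔭 S, p • s' = s :=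
    selmerAc_divisible_of_finite_pTorsion_anyTorsion (W.baseChange K) p κ hPT hEP h𝔭 h𝔮 hne hm₁ (hfin 𝔮 h𝔮) h2 γ
      (hγ := ⟨hγ⟩) hS hfinS
  -- local tower torsion finiteness in the `kerD` shape
  have hδ₁ : (FixedPoints.addSubgroup (kerD κ 𝔭) ((W.baseChange K).geomPrimaryTorsion p) :
      Set ((W.baseChange K).geomPrimaryTorsion p)).Finite := by
    rw [fixedPoints_kerD_eq]; exact hδ
  have hδ₂ : (FixedPoints.addSubgroup (kerD κ 𝔭) ((W'.baseChange K).geomPrimaryTorsion p) :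
      Set ((W'.baseChange K).geomPrimaryTorsion p)).Finite := by
    rw [fixedPoints_kerD_eq]; exact hδ'
  -- the (L)-free comparison along `e⁻¹ : W_K[p] ≅ W′_K[p]`
  exact natCard_selmerAc_pTorsion_eq_of_torsionIso_of_surj κ (W.baseChange K) (W'.baseChange K) hPT hEP h𝔭 h𝔮 hne hm₁
    (hfin 𝔮 h𝔮) h2 hγ hSW hSW' hv₀p hv₀S hc hle (hsurj' v₀ hv₀p hv₀S c hc hle) e.symm hes hG hdiv hfinS hdiv' hδ₁ hδ₂

/-! ### §2 Stub B′ from the wall + the three tower statements about the twin -/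

/-- **Stub B′'s conclusion VERBATIM from B′'s binders + (S′) + (Σ′) + (N′)** — NO base finiteness of the twin, NO (iv). The
twin's tower inputs, all for `E′_K = W′.baseChange K` over the anticyclotomic `K_∞` with strict place `𝔭′`:
`hsig'` (S′): for every `Σ`, every fake strict place `v₀ ∤ 3`, `v₀ ∉ Σ`, every right-`ker κ`-invariant left-`D_{𝔭′}`-equivariant
`F : Γ_K → H¹(kerD κ 𝔭′, E′[3^∞])` is the `𝔭′`-signature of some `s ∈ G_rel^Σ = selmerAc E′_K 3 κ v₀ Σ` (GV Prop. 2.1);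
`hsigS'` (Σ′): for every `Σ` and every finitely decomposed `v ∤ 3`, `v ∉ Σ`, every such `F` at `v` is the `v`-signature of some
`s ∈ Sel_{𝔭′}^{Σ∪{v}}` (GV Cor. 2.3); `hnf'` (N′): for every `Σ`, `X_{𝔭′}^Σ(E′_K)` has no non-zero finite `Λ`-submodule
(GV Prop. 2.5). Proof: bad set, `3` split, `μ(X_E) = 0` from the wall, `Sel^Σ(E)[3]` finite, the wild curve's local tower torsion
finiteness (Serre Prop. 8), the twin's (`localTowerTorsionFiniteAt_baseChange_three_of_not_addv`), (M1) = §1, the `Σ`-product of the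
twin by `natCard_quotient_pTorsion_eq_prod_of_surj`, then the FRAME `defectTransport_algebraicHalf_lambda_of_wall_of_residual`.
[cite: GreenbergVatsal2000, Thm. (1.4), §2 Prop. (2.1), Cor. (2.3), (2.4), (2.5), (2.8), (2.10) (pp. 23–28)]
[cite: GreenbergLNM1716, §4 Prop. 4.13–4.15 (pp. 122–126)] [cite: Serre1967GroupesPDivisibles, §5 Prop. 8] [cite: Brink2007, Cor. 1] -/
theorem defectTransport_algebraicHalf_lambda_of_wall_of_twinTower (W W' : WeierstrassCurve ℚ)
    [W.IsElliptic] [W.IsGloballyMinimal] [W'.IsElliptic] [W'.IsGloballyMinimal] {N N' : ℕ} (K : Type) [Field K]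
    [NumberField K]
    (hO6 : Additive.ClassO6 W 3) (hsurj : W.HasSurjectiveModNGaloisRep 3) (hN : W.conductorNorm ℤ = N)
    (hcong : O6.ModPCongruent W' W 3) (hadd' : ¬ Addv W' 3) (hN' : W'.conductorNorm ℤ = N')
    (hK : IsImaginaryQuadratic K)
    (hHe : SatisfiesHeegnerHypothesis N K) (hHe' : SatisfiesHeegnerHypothesis N' K)
    (κ : ZpExtension K 3) (hκ : κ.IsAnticyclotomic) (γ : absoluteGaloisGroup K)
    [Fact (κ.IsTopGenerator γ)] {𝔭' : HeightOneSpectrum (𝓞 K)} (h𝔭' : ((3 : ℕ) : 𝓞 K) ∈ 𝔭'.asIdeal)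
    (hT : Module.IsTorsion (IwasawaAlgebra 3) (XAc (W.baseChange K) 3 κ 𝔭' ∅ γ))
    {L : UnrSeries 3}
    (hle : Ideal.span {L} ≤
      (XAc.charIdeal (W.baseChange K) 3 κ 𝔭' ∅ γ).map (PowerSeries.map (Halves.toUnr 3)))
    (hi : ∃ i : ℕ, ‖((PowerSeries.coeff i L : unrIntegers 3) : ℂ_[3])‖ = 1)
    (hPT : poitouTate_selmerStructure_duality K) (hPT2 : poitouTate_sha_tateDual K)
    (hfin : ∀ v : HeightOneSpectrum (𝓞 K), ((3 : ℕ) : 𝓞 K) ∈ v.asIdeal →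
      Finite (selmerAcBase (W.baseChange K) 3 v ∅))
    (hsig' : ∀ (S : Set (HeightOneSpectrum (𝓞 K))) (v₀ : HeightOneSpectrum (𝓞 K)), ((3 : ℕ) : 𝓞 K) ∉ v₀.asIdeal →
      v₀ ∉ S → ∀ (F : absoluteGaloisGroup K → subgroupH1 (kerD κ 𝔭') ((W'.baseChange K).geomPrimaryTorsion 3)),
      (∀ (σ h : absoluteGaloisGroup K), h ∈ κ.kerSubgroup → F (σ * h) = F σ) →
      (∀ (d : decomp (K := K) 𝔭') (σ : absoluteGaloisGroup K), F ((d : absoluteGaloisGroup K) * σ) =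
        conjH1 (kerD κ 𝔭') ((W'.baseChange K).geomPrimaryTorsion 3) d (F σ)) →
      ∃ s ∈ selmerAc (W'.baseChange K) 3 κ v₀ S, ∀ σ : absoluteGaloisGroup K,
        resKerD κ ((W'.baseChange K).geomPrimaryTorsion 3) 𝔭' ((W'.baseChange K).conjH1 3 κ.kerSubgroup σ s) = F σ)
    (hsigS' : ∀ (S : Set (HeightOneSpectrum (𝓞 K))) (v : HeightOneSpectrum (𝓞 K)), ((3 : ℕ) : 𝓞 K) ∉ v.asIdeal →
      v ∉ S → ¬ (decomp v ≤ κ.kerSubgroup) →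
      ∀ (F : absoluteGaloisGroup K → subgroupH1 (kerD κ v) ((W'.baseChange K).geomPrimaryTorsion 3)),
      (∀ (σ h : absoluteGaloisGroup K), h ∈ κ.kerSubgroup → F (σ * h) = F σ) →
      (∀ (d : decomp (K := K) v) (σ : absoluteGaloisGroup K), F ((d : absoluteGaloisGroup K) * σ) =
        conjH1 (kerD κ v) ((W'.baseChange K).geomPrimaryTorsion 3) d (F σ)) →
      ∃ s ∈ selmerAc (W'.baseChange K) 3 κ 𝔭' (insert v S), ∀ σ : absoluteGaloisGroup K,
        resKerD κ ((W'.baseChange K).geomPrimaryTorsion 3) v ((W'.baseChange K).conjH1 3 κ.kerSubgroup σ s) = F σ)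
    (hnf' : ∀ (S : Set (HeightOneSpectrum (𝓞 K))) (M : Submodule (IwasawaAlgebra 3) (XAc (W'.baseChange K) 3 κ 𝔭' S γ)),
      Finite M → M = ⊥) :
    ∃ (T : Finset (HeightOneSpectrum (𝓞 K))) (c s s' : HeightOneSpectrum (𝓞 K) → ℕ),
      (↑T = {v : HeightOneSpectrum (𝓞 K) | ((3 : ℕ) : 𝓞 K) ∉ v.asIdeal ∧
        (¬ (W.baseChange K).HasGoodReductionAt v ∨ ¬ (W'.baseChange K).HasGoodReductionAt v)}) ∧
      (∀ v ∈ T, (∃ d₀ : decomp (K := K) v, (κ (d₀ : absoluteGaloisGroup K)).toAdd = (3 : ℤ_[3]) ^ c v) ∧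
        (∀ d : decomp (K := K) v, (3 : ℤ_[3]) ^ c v ∣ (κ (d : absoluteGaloisGroup K)).toAdd) ∧
        Nat.card {f : subgroupH1 (kerD κ v) ((W.baseChange K).geomPrimaryTorsion 3) // 3 • f = 0} =
          3 ^ s v ∧
        Nat.card {f : subgroupH1 (kerD κ v) ((W'.baseChange K).geomPrimaryTorsion 3) // 3 • f = 0} =
          3 ^ s' v) ∧
      (∃ g : UnrSeries 3,
        (XAc.charIdeal (W.baseChange K) 3 κ 𝔭' ∅ γ).map (PowerSeries.map (Halves.toUnr 3)) =
            Ideal.span {g} ∧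
          (∀ i < lambdaInvariant 3 (XAc (W.baseChange K) 3 κ 𝔭' ∅ γ),
            ‖((PowerSeries.coeff i g : unrIntegers 3) : ℂ_[3])‖ < 1) ∧
          ‖((PowerSeries.coeff (lambdaInvariant 3 (XAc (W.baseChange K) 3 κ 𝔭' ∅ γ)) g :
            unrIntegers 3) : ℂ_[3])‖ = 1) ∧
      Module.IsTorsion (IwasawaAlgebra 3) (XAc (W'.baseChange K) 3 κ 𝔭' ∅ γ) ∧
      (∃ g' : UnrSeries 3,
        (XAc.charIdeal (W'.baseChange K) 3 κ 𝔭' ∅ γ).map (PowerSeries.map (Halves.toUnr 3)) =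
            Ideal.span {g'} ∧
          (∀ i < lambdaInvariant 3 (XAc (W'.baseChange K) 3 κ 𝔭' ∅ γ),
            ‖((PowerSeries.coeff i g' : unrIntegers 3) : ℂ_[3])‖ < 1) ∧
          ‖((PowerSeries.coeff (lambdaInvariant 3 (XAc (W'.baseChange K) 3 κ 𝔭' ∅ γ)) g' :
            unrIntegers 3) : ℂ_[3])‖ = 1) ∧
      lambdaInvariant 3 (XAc (W.baseChange K) 3 κ 𝔭' ∅ γ) + ∑ v ∈ T, 3 ^ c v * s v =
        lambdaInvariant 3 (XAc (W'.baseChange K) 3 κ 𝔭' ∅ γ) + ∑ v ∈ T, 3 ^ c v * s' v  := by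
  haveI : Fact (Nat.Prime 3) := ⟨Nat.prime_three⟩
  -- the bad set `Σ`
  set S : Set (HeightOneSpectrum (𝓞 K)) := {v | ((3 : ℕ) : 𝓞 K) ∉ v.asIdeal ∧
    (¬ (W.baseChange K).HasGoodReductionAt v ∨ ¬ (W'.baseChange K).HasGoodReductionAt v)} with hSdef
  have hSfin : S.Finite := by
    refine (((W.baseChange K).finite_badPlaces_holds (𝓞 K)).union
      ((W'.baseChange K).finite_badPlaces_holds (𝓞 K))).subset fun v hv ↦ ?_
    rcases hv.2 with h | h
    · exact Or.inl h
    · exact Or.inr h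
  have hSp : ∀ v ∈ S, ((3 : ℕ) : 𝓞 K) ∉ v.asIdeal := fun v hv ↦ hv.1
  have hSdec : ∀ v ∈ S, ¬ (decomp v ≤ κ.kerSubgroup) := by
    intro v hv
    rcases hv.2 with h | h
    · exact not_decomp_le_kerSubgroup_of_not_hasGoodReductionAt_baseChange W hN K hK hHe (by decide) κ
        hκ hv.1 h
    · exact not_decomp_le_kerSubgroup_of_not_hasGoodReductionAt_baseChange W' hN' K hK hHe' (by decide)
        κ hκ hv.1 h
  have hgood : ∀ v : HeightOneSpectrum (𝓞 K), v ∉ S → ((3 : ℕ) : 𝓞 K) ∉ v.asIdeal →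
      (W.baseChange K).HasGoodReductionAt v := fun v hv hpv ↦ by
    by_contra h; exact hv ⟨hpv, Or.inl h⟩
  have hgood' : ∀ v : HeightOneSpectrum (𝓞 K), v ∉ S → ((3 : ℕ) : 𝓞 K) ∉ v.asIdeal →
      (W'.baseChange K).HasGoodReductionAt v := fun v hv hpv ↦ by
    by_contra h; exact hv ⟨hpv, Or.inr h⟩
  -- `3` splits in the Heegner field
  have hadd : Addv W 3 := hO6.2.1
  have hpN : 3 ∣ W.conductorNorm ℤ := (W.dvd_conductorNorm_iff_not_hasGoodReductionAtPrime 3).mpr hadd.1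
  have hsplit : SplitsIn K 3 := hHe 3 (Fact.out) (hN ▸ hpN)
  -- `Sel^Σ(E)[3]` is finite: `μ(X_E) = 0` from the wall
  haveI := XAc.module_finite κ 𝔭' (∅ : Set (HeightOneSpectrum (𝓞 K))) γ Set.finite_empty (W := W.baseChange K)
  have hμe : muInvariant 3 (XAc (W.baseChange K) 3 κ 𝔭' ∅ γ) = 0 :=
    muInvariant_eq_zero_of_span_le_map_charIdeal (XAc (W.baseChange K) 3 κ 𝔭' ∅ γ) hT hle hi
  have hfine : Set.Finite {s : selmerAc (W.baseChange K) 3 κ 𝔭' ∅ | 3 • s = 0} :=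
    finite_pTorsion_of_muInvariant_eq_zero (W.baseChange K) 3 κ 𝔭' ∅ γ hT hμe
  have hfinS : Set.Finite {s : selmerAc (W.baseChange K) 3 κ 𝔭' S | 3 • s = 0} :=
    finite_selmerAc_pTorsion_of_empty (W.baseChange K) κ hSfin hSp hSdec hfine
  -- the wild curve's local tower torsion at `𝔭′` is finite (Serre 1967 Prop. 8 on the O6 class)
  have hδ : LocalTowerTorsionFiniteAt (W.baseChange K) 3 κ 𝔭' :=
    localTowerTorsionFiniteClaim_three_of_classO6 Serre1967.noStableDivisibleLine_of_potentiallySupersingular_holds W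
      hO6 K hK hsplit κ hκ 𝔭' h𝔭'
  -- the twin's local tower torsion at `𝔭′` is finite (by reduction type)
  have hδ' : LocalTowerTorsionFiniteAt (W'.baseChange K) 3 κ 𝔭' :=
    localTowerTorsionFiniteAt_baseChange_three_of_not_addv W' hadd' hK hsplit κ hκ 𝔭' h𝔭'
  -- (S′) in tuple form at `𝔭′` (for the data chosen inside (M1))
  have hsurj' : ∀ (v₀ : HeightOneSpectrum (𝓞 K)), ((3 : ℕ) : 𝓞 K) ∉ v₀.asIdeal → v₀ ∉ S → ∀ (c : ℕ),
      (∀ z : ℤ_[3], ∃ d : decomp (K := K) 𝔭', (κ (d : absoluteGaloisGroup K)).toAdd = (3 : ℤ_[3]) ^ c * z) →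
      (∀ d : decomp (K := K) 𝔭', (3 : ℤ_[3]) ^ c ∣ (κ (d : absoluteGaloisGroup K)).toAdd) →
      ∀ g : Fin (3 ^ c) → subgroupH1 (kerD κ 𝔭') ((W'.baseChange K).geomPrimaryTorsion 3),
        ∃ s ∈ selmerAc (W'.baseChange K) 3 κ v₀ S, ∀ i : Fin (3 ^ c),
          resKerD κ ((W'.baseChange K).geomPrimaryTorsion 3) 𝔭'
            ((W'.baseChange K).conjH1 3 κ.kerSubgroup (γ ^ (i : ℕ)) s) = g i := by
    intro v₀ hv₀ hv₀S c hc hle g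
    exact exists_mem_forall_fin_of_forall_sig (W'.baseChange K) 3 κ (Fact.out : κ.IsTopGenerator γ) 𝔭' hc hle
      (selmerAc (W'.baseChange K) 3 κ v₀ S) (hsig' S v₀ hv₀ hv₀S) g
  -- (M1) with the twin's tower inputs, then the Σ-product of the twin, then the FRAME
  have hcmp := natCard_selmerAc_pTorsion_baseChange_eq_of_modPCongruent_of_twinTower W W' 3 (by decide) hK hsplit hPT hPT2
    κ hκ (γ := γ) Fact.out h𝔭' (by exact_mod_cast hsurj) hcong hSfin hgood hgood' hfin hsurj'
    (fun hfinS' ↦ selmerAc_divisible_of_finite_pTorsion_of_noFinite (W'.baseChange K) 3 κ 𝔭' γ hSfin hfinS' (hnf' S))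
    hfinS hδ hδ'
  have hprodTwin : ∀ (hS : Set.Finite S) (c : HeightOneSpectrum (𝓞 K) → ℕ),
      (∀ v ∈ S, ∀ z : ℤ_[3], ∃ d : decomp (K := K) v, (κ (d : absoluteGaloisGroup K)).toAdd = (3 : ℤ_[3]) ^ c v * z) →
      (∀ v ∈ S, ∀ d : decomp (K := K) v, (3 : ℤ_[3]) ^ c v ∣ (κ (d : absoluteGaloisGroup K)).toAdd) →
      Set.Finite {s : selmerAc (W'.baseChange K) 3 κ 𝔭' S | 3 • s = 0} →
      Nat.card {b : selmerAc (W'.baseChange K) 3 κ 𝔭' S ⧸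
          (selmerAc (W'.baseChange K) 3 κ 𝔭' ∅).addSubgroupOf (selmerAc (W'.baseChange K) 3 κ 𝔭' S) // 3 • b = 0} =
        ∏ v ∈ hS.toFinset, Nat.card {f : subgroupH1 (kerD κ v) ((W'.baseChange K).geomPrimaryTorsion 3) //
          3 • f = 0} ^ (3 ^ c v) := by
    intro hS c hc hle hfinS'
    have hT : S = ∅ ∪ ↑hS.toFinset := by rw [Set.empty_union, Set.Finite.coe_toFinset]
    have key := natCard_quotient_pTorsion_eq_prod_of_surj (W'.baseChange K) 3 κ (𝔭 := 𝔭') (Fact.out : κ.IsTopGenerator γ) ∅ c hS.toFinset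
      (fun v hv ↦ hSp v ((Set.Finite.mem_toFinset hS).mp hv)) (fun v _ ↦ Set.notMem_empty v)
      (fun v hv ↦ hc v ((Set.Finite.mem_toFinset hS).mp hv))
      (fun v hv S' _ _ hvS' f ↦ by
        have hv' := (Set.Finite.mem_toFinset hS).mp hv
        exact exists_mem_forall_fin_of_forall_sig (W'.baseChange K) 3 κ (Fact.out : κ.IsTopGenerator γ) v (hc v hv') (hle v hv')
          (selmerAc (W'.baseChange K) 3 κ 𝔭' (insert v S')) (hsigS' S' v (hSp v hv') hvS' (hSdec v hv')) f)
      (fun T' hT' ↦ by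
        have hsub : (∅ : Set (HeightOneSpectrum (𝓞 K))) ∪ ↑T' ⊆ S := by
          rw [Set.empty_union]; exact fun v hv ↦ (Set.Finite.mem_toFinset hS).mp (hT' hv)
        exact selmerAc_divisible_of_finite_pTorsion_of_noFinite (W'.baseChange K) 3 κ 𝔭' γ
          (hS.subset hsub) (finite_selmerAc_pTorsion_of_subset (W'.baseChange K) 3 κ hsub hfinS') (hnf' _))
    rw [← hT] at key
    exact key
  exact defectTransport_algebraicHalf_lambda_of_wall_of_residual W W' K hO6 hN hN' hK hHe hHe' κ hκ γ h𝔭' hT hle hi hPT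
    hPT2 hfin hcmp (hnf' ∅) hprodTwin

end Summit.BirchSwinnertonDyer.BirchSwinnertonDyer.Theorems.UniversalToricDescentDefectTransport

end
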